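import Mathlib
import Summits.HubbardSuperconductivity.HubbardSuperconductivity.Theses.BalabanIR

/-!
# Sketch — crux-ideate stmt-HubbardSuperconductivity-2081 (`BalabanIR.BirBdGPhaseCoercivity`), ideator 2 (round 1)

First lemmas of the idea card `feshbach-shell-logdet` (they only need to ELABORATE; proofs are `sorry`):

* `sum_abs_eigenvalues_eq_integral_logdet` — the imaginary-mass representation of the trace norm,
  `Σ|λ_i(A)| = π⁻¹ ∫₀^∞ log det(1 + A²/s²) ds`, which makes `S(θ)` a superposition of free-fermion
  log-determinants with mass `s`, so that Schur/Feshbach elimination becomes available;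
* `det_add_eq_twoFluid` — the two-fluid determinant identity
  `det(T + V) = det T · det(1 + C₂V) · det(1 + C₁ V (1 + C₂V)⁻¹)` for any splitting `T⁻¹ = C₁ + C₂`
  (here: `T = H_normal + is`, `C₂ = χ̄(H_n)² T⁻¹` the off-shell covariance, `C₁ = χ(H_n)² T⁻¹` the shell one);
* `log_det_le_tangent` — concavity of `log det` on positive definite matrices (the shell factor is bounded
  by its tangent at the uniform paired reference, whose weights are the PHYSICAL shell weights);
* the typed leading-order (sharp-cutoff) TWO-FLUID SYMBOL `tfSym` and the Brillouin-zone inequality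
  `TwoFluidSymbolIneq μ Δ₁ Δ₂ ω₀` that the kit/pure-python numerics of the card test.
-/

noncomputable section

set_option linter.dupNamespace false
set_option linter.unusedVariables false

namespace Summit.HubbardSuperconductivity.HubbardSuperconductivity.Cruxes.BirBdGPhaseCoercivity.SketchIdeator2

open scoped BigOperators Matrix ComplexOrder ComplexConjugate
open Real Finset MeasureTheory Classical Literature.Probability.LatticeModels

/-! ## Structural lemmas -/

/-- **Imaginary-mass (log-det) representation of the trace norm.** For Hermitian `A`,
`Σ_i |λ_i(A)| = π⁻¹ ∫₀^∞ log det(1 + s⁻² A²) ds` (scalar identity `∫₀^∞ log(1 + λ²/s²) ds = π|λ|`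
applied eigenvalue-wise; `det(1 + s⁻²A²) = Π_i (1 + λ_i²/s²)` is real and `≥ 1`). -/
theorem sum_abs_eigenvalues_eq_integral_logdet {n : Type*} [Fintype n] [DecidableEq n]
    (A : Matrix n n ℂ) (hA : A.IsHermitian) :
    ∑ i, |hA.eigenvalues i|
      = π⁻¹ * ∫ s in Set.Ioi (0 : ℝ), Real.log (((1 : Matrix n n ℂ) + ((s : ℂ)⁻¹ ^ 2) • (A * A)).det.re) := by
  sorry

/-- **Two-fluid determinant identity** (exact; the algebraic heart of the lever). If `T` is invertible,
`T⁻¹ = C₁ + C₂` and `1 + C₂ V` is invertible, then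
`det(T + V) = det T · det(1 + C₂ V) · det(1 + C₁ V (1 + C₂ V)⁻¹)`.
Proof: `T + V = T (1 + C₂V + C₁V) = T (1 + C₂V) (1 + (1 + C₂V)⁻¹ C₁ V)` and Sylvester
`det(1 + XY) = det(1 + YX)`. With `T = H_n + is`, `C₂ =` off-shell part, `C₁ =` shell part of `T⁻¹`,
the middle factor is a convergent off-shell expansion and the last factor is the renormalised shell
determinant `det(T + χ V_eff χ)/det T`, `V_eff = V (1 + C₂V)⁻¹`. -/
theorem det_add_eq_twoFluid {n : Type*} [Fintype n] [DecidableEq n]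
    (T V C₁ C₂ : Matrix n n ℂ) (hT : IsUnit T) (hC : T⁻¹ = C₁ + C₂) (h₂ : IsUnit (1 + C₂ * V)) :
    (T + V).det = T.det * (1 + C₂ * V).det * (1 + C₁ * V * (1 + C₂ * V)⁻¹).det := by
  sorry

/-- **Tangent bound for `log det`** (concavity on the positive definite cone): for positive definite
`M`, `M₀`, `log det M ≤ log det M₀ + Tr(M₀⁻¹ (M - M₀))` (eigenvalues `μ_i` of `M₀^{-1/2} M M₀^{-1/2}`
satisfy `log μ_i ≤ μ_i - 1`). Used with `M = F_u(s)† F_u(s)` (shell factor of the textured matrix) and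
`M₀ = F_1(s)† F_1(s) = ⊕_k (E_k² + s²)·1₂` deep in the shell. -/
theorem log_det_le_tangent {n : Type*} [Fintype n] [DecidableEq n]
    (M M₀ : Matrix n n ℂ) (hM : M.PosDef) (h₀ : M₀.PosDef) :
    Real.log M.det.re ≤ Real.log M₀.det.re + ((M₀⁻¹ * (M - M₀)).trace).re := by
  sorry

/-! ## The leading-order two-fluid symbol (sharp-cutoff model, as tested numerically) -/

/-- momentum angle `2π k_i / L` of a torus index. -/
def ang (L : ℕ) (k : TorusSite 2 L) (i : Fin 2) : ℝ := 2 * π * ((k i).val : ℝ) / L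

/-- band energy `ξ_p = -2 cos p₁ - 2 cos p₂ - μ`. -/
def xi (μ : ℝ) (L : ℕ) (p : TorusSite 2 L) : ℝ := -2 * Real.cos (ang L p 0) - 2 * Real.cos (ang L p 1) - μ

/-- chiral gap function `Δ_p = 2Δ₁(cos p₁ - cos p₂) - 4 i Δ₂ sin p₁ sin p₂`. -/
def gap (Δ₁ Δ₂ : ℝ) (L : ℕ) (p : TorusSite 2 L) : ℂ :=
  (2 * Δ₁ * (Real.cos (ang L p 0) - Real.cos (ang L p 1)) : ℝ) -
    Complex.I * (4 * Δ₂ * Real.sin (ang L p 0) * Real.sin (ang L p 1) : ℝ)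

/-- quasiparticle energy `E_p = √(ξ_p² + |Δ_p|²)`. -/
def qpE (μ Δ₁ Δ₂ : ℝ) (L : ℕ) (p : TorusSite 2 L) : ℝ := Real.sqrt (xi μ L p ^ 2 + ‖gap Δ₁ Δ₂ L p‖ ^ 2)

/-- XY dispersion `ε(k) = 4 - 2cos k₁ - 2cos k₂`. -/
def epsXY (L : ℕ) (k : TorusSite 2 L) : ℝ := 4 - 2 * Real.cos (ang L k 0) - 2 * Real.cos (ang L k 1)

/-- coherence factor `u_p² = (1 + ξ_p/E_p)/2`. -/
def cohU2 (μ Δ₁ Δ₂ : ℝ) (L : ℕ) (p : TorusSite 2 L) : ℝ := (1 + xi μ L p / qpE μ Δ₁ Δ₂ L p) / 2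

/-- `Φ_p = (E_p - ξ_p) Δ_p / |Δ_p|² = Δ_p/(E_p + ξ_p)` (`= 0` at the two gap zeros by `x/0 = 0`). -/
def phiK (μ Δ₁ Δ₂ : ℝ) (L : ℕ) (p : TorusSite 2 L) : ℂ :=
  ((qpE μ Δ₁ Δ₂ L p - xi μ L p : ℝ) : ℂ) * gap Δ₁ Δ₂ L p / ((‖gap Δ₁ Δ₂ L p‖ ^ 2 : ℝ) : ℂ)

/-- pair form factor of a texture mode `k`: `m_p(k) = (Δ_p + Δ_{p+k})/2`. -/
def mq (Δ₁ Δ₂ : ℝ) (L : ℕ) (p k : TorusSite 2 L) : ℂ := (gap Δ₁ Δ₂ L p + gap Δ₁ Δ₂ L (p + k)) / 2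

/-- exact second-order (θ-Hessian) kernel term around the uniform paired state:
`4 u_p² u_{p+k}² |m + m̄ Φ_p Φ_{p+k}|² / (E_p + E_{p+k})` (Goldstone-consistent; used for MIXED pairs). -/
def exTerm (μ Δ₁ Δ₂ : ℝ) (L : ℕ) (p k : TorusSite 2 L) : ℝ :=
  4 * cohU2 μ Δ₁ Δ₂ L p * cohU2 μ Δ₁ Δ₂ L (p + k)
    * ‖mq Δ₁ Δ₂ L p k + conj (mq Δ₁ Δ₂ L p k) * phiK μ Δ₁ Δ₂ L p * phiK μ Δ₁ Δ₂ L (p + k)‖ ^ 2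
    / (qpE μ Δ₁ Δ₂ L p + qpE μ Δ₁ Δ₂ L (p + k))

/-- frozen-metric kernel term `|m|² (1/E_p + 1/E_{p+k})` (used for SHELL–SHELL pairs only). -/
def frTerm (μ Δ₁ Δ₂ : ℝ) (L : ℕ) (p k : TorusSite 2 L) : ℝ :=
  ‖mq Δ₁ Δ₂ L p k‖ ^ 2 * ((qpE μ Δ₁ Δ₂ L p)⁻¹ + (qpE μ Δ₁ Δ₂ L (p + k))⁻¹)

/-- normal-state pair-bubble kernel term `4|m|²·[ξξ'>0]/(|ξ_p| + |ξ_{p+k}|)` (OFF-SHELL pairs: exact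
second order around the normal state, the correct two-particle denominator). -/
def nbTerm (μ Δ₁ Δ₂ : ℝ) (L : ℕ) (p k : TorusSite 2 L) : ℝ :=
  if 0 < xi μ L p * xi μ L (p + k) then 4 * ‖mq Δ₁ Δ₂ L p k‖ ^ 2 / (|xi μ L p| + |xi μ L (p + k)|) else 0

/-- **Two-fluid symbol** `𝒢^tf_L(k)` with a sharp shell `|ξ| ≤ ω₀` (leading-order model of the Feshbach
scheme; the proof-grade version carries smooth cutoff weights `χ(ξ)`): reference gain
`Σ_p [2|Δ_p|²/E_p (shell) | 2|Δ_p|²/|ξ_p| (off-shell)]` minus the texture's credit, pair by pair, with the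
kernel of the sector the pair `(p, p+k)` belongs to. -/
def tfSym (μ Δ₁ Δ₂ ω₀ : ℝ) (L : ℕ) [NeZero L] (k : TorusSite 2 L) : ℝ :=
  (∑ p : TorusSite 2 L,
      (if |xi μ L p| ≤ ω₀ then 2 * ‖gap Δ₁ Δ₂ L p‖ ^ 2 / qpE μ Δ₁ Δ₂ L p
       else 2 * ‖gap Δ₁ Δ₂ L p‖ ^ 2 / |xi μ L p|))
  - ∑ p : TorusSite 2 L,
      (if |xi μ L p| ≤ ω₀ ∧ |xi μ L (p + k)| ≤ ω₀ then frTerm μ Δ₁ Δ₂ L p k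
       else if ¬ (|xi μ L p| ≤ ω₀) ∧ ¬ (|xi μ L (p + k)| ≤ ω₀) then nbTerm μ Δ₁ Δ₂ L p k
       else exTerm μ Δ₁ Δ₂ L p k)

/-- **Two-fluid symbol inequality** `C⁺_tf(μ,Δ₁,Δ₂; ω₀)`: uniformly in large `L`,
`𝒢^tf_L(k) ≥ 2 c₀ L² ε(k)` for all texture momenta `k`. Numerically TRUE (c₀ ≈ the exact Hessian
constant, argmin k = (π,π)) at every tested band-edge point where the frozen certificate is negative. -/
def TwoFluidSymbolIneq (μ Δ₁ Δ₂ ω₀ : ℝ) : Prop :=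
  ∃ c₀ : ℝ, 0 < c₀ ∧ ∃ L₀ : ℕ, ∀ (L : ℕ) [NeZero L], L₀ ≤ L →
    ∀ k : TorusSite 2 L, c₀ * epsXY L k ≤ tfSym μ Δ₁ Δ₂ ω₀ L k / (2 * (L : ℝ) ^ 2)

/-- **Target of the line** (weak-coupling corner, to be proved via the three structural lemmas, the
convergent off-shell expansion and the inversion-symmetric locality lemma): if the two-fluid symbol
inequality holds with a shell that dominates the pairing scale, `16·√(Δ₁²+Δ₂²) ≤ ω₀` (so that
`max_p |Δ_p| ≤ ω₀/4`), then the crux's inequality holds at `(μ,Δ₁,Δ₂)`; stated here as an abbreviation of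
the crux's matrix inequality at one parameter point. -/
def CoerciveAt (μ Δ₁ Δ₂ : ℝ) : Prop :=
  ∃ c₀ : ℝ, 0 < c₀ ∧ ∃ L₀ : ℕ, ∀ (L : ℕ) [NeZero L], L₀ ≤ L → let nnx : Literature.Probability.LatticeModels.TorusSite 2 L → Literature.Probability.LatticeModels.TorusSite 2 L → Prop := fun x y => y = x + ![1, 0] ∨ y = x + ![-1, 0]; let nny : Literature.Probability.LatticeModels.TorusSite 2 L → Literature.Probability.LatticeModels.TorusSite 2 L → Prop := fun x y => y = x + ![0, 1] ∨ y = x + ![0, -1]; let dg1 : Literature.Probability.LatticeModels.TorusSite 2 L → Literature.Probability.LatticeModels.TorusSite 2 L → Prop := fun x y => y = x + ![1, 1] ∨ y = x + ![-1, -1]; let dg2 : Literature.Probability.LatticeModels.TorusSite 2 L → Literature.Probability.LatticeModels.TorusSite 2 L → Prop := fun x y => y = x + ![1, -1] ∨ y = x + ![-1, 1]; let h : Matrix (Literature.Probability.LatticeModels.TorusSite 2 L) (Literature.Probability.LatticeModels.TorusSite 2 L) ℂ := fun x y => -(if nnx x y ∨ nny x y then (1 : ℂ) else 0) - (if x = y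 then (μ : ℂ) else 0); let D : (Literature.Probability.LatticeModels.TorusSite 2 L → ℝ) → Matrix (Literature.Probability.LatticeModels.TorusSite 2 L) (Literature.Probability.LatticeModels.TorusSite 2 L) ℂ := fun θ x y => ((Δ₁ : ℂ) * ((if nnx x y then (1 : ℂ) else 0) - (if nny x y then (1 : ℂ) else 0)) + Complex.I * (Δ₂ : ℂ) * ((if dg1 x y then (1 : ℂ) else 0) - (if dg2 x y then (1 : ℂ) else 0))) * (Complex.exp (Complex.I * (θ x : ℂ)) + Complex.exp (Complex.I * (θ y : ℂ))) / 2; let Hb : (Literature.Probability.LatticeModels.TorusSite 2 L → ℝ) → Matrix (Literature.Probability.LatticeModels.TorusSite 2 L ⊕ Literature.Probability.LatticeModels.TorusSite 2 L) (Literature.Probability.LatticeModels.TorusSite 2 L ⊕ Literature.Probability.LatticeModels.TorusSite 2 L) ℂ := fun θ => Matrix.fromBlocks h (D θ) (Matrix.conjTranspose (D θ)) (-h); ∀ θ : Literature.Probability.LatticeModels.TorusSite 2 L → ℝ, ∀ (hθ : (Hb θ).IsHermitian) (h0 : (Hb (fun _ => 0)).IsHermitian), c₀ * ∑ x : Literature.Probability.LatticeModels.TorusSite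 2 L, ∑ y : Literature.Probability.LatticeModels.TorusSite 2 L, (if nnx x y ∨ nny x y then (1 - Real.cos (θ x - θ y)) else 0) ≤ ∑ i, |h0.eigenvalues i| - ∑ i, |hθ.eigenvalues i|

/-- the crux is literally `∀ (μ,Δ₁,Δ₂) admissible, CoerciveAt μ Δ₁ Δ₂` (definitional). -/
theorem crux_iff_coerciveAt :
    Summit.HubbardSuperconductivity.HubbardSuperconductivity.Theses.BalabanIR.BirBdGPhaseCoercivity ↔
      ∀ μ Δ₁ Δ₂ : ℝ, μ ∈ Set.Ioo (-4 : ℝ) 4 → Δ₁ ≠ 0 → Δ₂ ≠ 0 → CoerciveAt μ Δ₁ Δ₂ :=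
  Iff.rfl

/-- **The line's theorem in the weak-coupling corner** (to be proved): two-fluid symbol inequality with a
shell dominating the pairing scale ⇒ the crux at that parameter point. -/
theorem coerciveAt_of_twoFluid (μ Δ₁ Δ₂ ω₀ : ℝ) (hμ : μ ∈ Set.Ioo (-4 : ℝ) 4) (h₁ : Δ₁ ≠ 0) (h₂ : Δ₂ ≠ 0)
    (hω : 16 * Real.sqrt (Δ₁ ^ 2 + Δ₂ ^ 2) ≤ ω₀) (htf : TwoFluidSymbolIneq μ Δ₁ Δ₂ ω₀) :
    CoerciveAt μ Δ₁ Δ₂ := by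
  sorry

end Summit.HubbardSuperconductivity.HubbardSuperconductivity.Cruxes.BirBdGPhaseCoercivity.SketchIdeator2
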